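import Summits.ResolutionOfSingularities.ResolutionOfSingularities.Theorems.CompanionCutCells
import Summits.ResolutionOfSingularities.ResolutionOfSingularities.Theorems.MaxContactCutKangarooCut
import Summits.ResolutionOfSingularities.ResolutionOfSingularities.Theorems.ContactFreeIsPPower
import HarnessLib

/-!
# MaxContactCutCompanionCut — decomp-res node «CompanionCut» (lens-4 g26, critic row 154), tree file 7/7 of the node

Content VERBATIM from the decomp-res lens-4 g26 node `HOME/decomp-res-lens-4/g26/CompanionCut.lean` (pin 12d9bf52, 1
262 l, 56 declarations;
HOME = run/shared/lean/pub/decomp-res) = ONE NEW PART §66–§70, NO CARRY, on top of the landed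
`Theorems/HeightCutCells` (g25) +
`Theorems/MaxContactCutKangarooCut` (h71 wiring) + `Theorems/ContactFreeIsPPower` (lens-6).  Critic: CRITIC-LEDGER
row 154 (CLEARED
2026-08-30T23:45:15Z, DECIDED +1 (ii*): THE COMPANION LAW at every weight — Hasse descent of a `p^e`-power form to
a weight-`p^e`
companion with LINEAR weak contact, Giraud transport with a typed jump dichotomy in every weight, the deciding implication
«eventually companion-jump-free ⇒ 31571's class» and the EXACT re-location of the g25 residual
`NoWildKangarooOffDoublePointTowers`
to the companion-recurrent towers `NoWildCompanionKangarooTowers`; inhabitants both sides).  Landing orders INBOX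
:519 (lens-4 g26
landing note, split per NEXT-g27 §4) and :528 (critic): `--kind proof --supports
stmt-ResolutionOfSingularities-28338`, namespace
`…Theorems.HugValuationCut`.  Landed by decomp-res writer g8 CONE-AWARE in seven files: `CompanionAlgebra` ·
`CompanionHasse` ·
`CompanionPresentation` (§66–§67) · `CompanionTransport` (§68) · `CompanionTowers` (§69) ·
`CompanionCutCells` (§70 cone-free cells and
hypothesis-free re-locations) are OUTSIDE the Theses cone (importable by the route file); the five §70 corollaries GIVEN 31571
`MaxContactCut.NoContactHuggingTowers` BY NAME are the in-cone wiring file `MaxContactCutCompanionCut`.  Aside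
bookkeeping (row 154):
ONE successor aside on the lens-4 column, `NoWildCompanionKangarooTowers` (home `CompanionCutCells`) SUPERSEDING
`HCNoWildKangarooOffDoublePointTowers` (g25, route rev 43); exactness `noWildKangarooOffDoublePointTowers_iff_companion (h71)`;
the decided cell `NoWildCompanionJumpFreeTowers` (⟸ 31571, `noWildCompanionJumpFreeTowers_of_item`) is not filed.

§70, IN-CONE PART: the corollaries GIVEN the MaxContactCut item 31571 `MaxContactCut.NoContactHuggingTowers` BY NAME —
`noWildCompanionJumpFreeTowers_of_item` (the decided cell), `noWildKangarooOffDoublePointTowers_iff_companion (h71)`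
(= the exactness
certificate of the aside supersession `HCNoWildKangarooOffDoublePointTowers` ↦ `NoWildCompanionKangarooTowers`),
`noWildKangarooOffLocusTowers_iff_g26 (h71)`,
`noWildPPowerOffLocusTowers_iff_g26 (h71)` (via the landed `MaxContactCutKangarooCut`),
`noWildContactFreeOffLocusTowers_iff_g26 (h71)` (via lens-6's
landed `ContactFreeIsPPower`): the tree aside 28338 ⟺ the g26 residual given 31571.  INSIDE the Theses cone
(wiring file; never imported
by the route file).

[WRITER NOTE (decomp-res writer g8): section split only (400-line cap; §66 `section CompanionAlgebra` is re-opened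
with the same
`variable` lines in `CompanionHasse` / `CompanionPresentation`); namespace, universes, section variables and every
declaration exactly
as in the lens (global `set_option` dropped; the lens's in-cone import `MaxContactCutKangarooCut` and the `open
…Theses` line live only
in the wiring file `MaxContactCutCompanionCut`).]

(Sources: Giraud1975 Thm 5.2; EncinasVillamayor2000 Thm 4.9; BravoGarciaEscamillaEncinasVillamayor2012 Lemma 4.6;
KawanoueMatsuki2010; Kawanoue arXiv:math/0607009; CossartPiltant2008 §2; Cossart2011 ex. III.2; Hauser
arXiv:0811.4151; FruehbisKrueger arXiv:1007.2203 §3; BenitoVillamayor arXiv:1004.1803; Lucas 1878.)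
-/

noncomputable section

open CategoryTheory AlgebraicGeometry IsLocalRing
open Literature.AlgebraicGeometry.Resolution
open Summit.ResolutionOfSingularities.ResolutionOfSingularities.Theses
open Summit.ResolutionOfSingularities.ResolutionOfSingularities.Theorems
open WeakOrderReduction ForcedTowerClasses DivergentTowerClasses MonomialTowerClasses
open HugDimensionClasses HugDimensionKernels SurfaceShadowClasses SurfaceShadowKernels
open NearPointCut (SingularClass)
open AbsoluteContactClasses (IsAbsContactAt SepResidueAt diffIdeal_restrict_le stalkMap_comp_toStalk_eq_stalkHom)
open scoped BigOperators

namespace Summit.ResolutionOfSingularities.ResolutionOfSingularities.Theorems.HugValuationCut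

section CompanionCells

/-- **THE COMPANION-JUMP-FREE BED FROM 31571 BY NAME** (`MaxContactCut.NoContactHuggingTowers`, no port). [folklore] -/
theorem noWildCompanionJumpFreeTowers_of_item (h : MaxContactCut.NoContactHuggingTowers) : NoWildCompanionJumpFreeTowers :=
  fun n hn => wildCompanionJumpFree_of_contact (h n hn)

/-- **EXACT GIVEN 31571 BY NAME: the g25 residual ⟺ the companion-recurrent bed.** [folklore] -/
theorem noWildKangarooOffDoublePointTowers_iff_companion (h71 : MaxContactCut.NoContactHuggingTowers) :
    NoWildKangarooOffDoublePointTowers ↔ NoWildCompanionKangarooTowers := by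
  rw [noWildKangarooOffDoublePointTowers_iff_g26]
  exact ⟨fun h => h.2, fun h => ⟨noWildCompanionJumpFreeTowers_of_item h71, h⟩⟩

/-- **GIVEN 31571 BY NAME: g24's kangaroo residual ⟺ the g26 residual** (hypothesis-free g25 re-location + g26). [folklore] -/
theorem noWildKangarooOffLocusTowers_iff_g26 (h71 : MaxContactCut.NoContactHuggingTowers) :
    NoWildKangarooOffLocusTowers ↔ NoWildCompanionKangarooTowers := by
  rw [noWildKangarooOffLocusTowers_iff_g25, noWildKangarooOffDoublePointTowers_iff_companion h71]

/-- **GIVEN 31571 BY NAME: g23's `p`-power residual ⟺ the g26 residual.** [folklore] -/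
theorem noWildPPowerOffLocusTowers_iff_g26 (h71 : MaxContactCut.NoContactHuggingTowers) :
    NoWildPPowerOffLocusTowers ↔ NoWildCompanionKangarooTowers := by
  rw [noWildPPowerOffLocusTowers_iff_kangaroo h71, noWildKangarooOffLocusTowers_iff_g26 h71]

/-- **GIVEN 31571 BY NAME, THE TREE ASIDE 28338 ⟺ THE g26 RESIDUAL** — `NoWildContactFreeOffLocusTowers` ⟺
`NoWildPPowerOffLocusTowers` (lens-6 `noWildContactFreeOffLocusTowers_iff_pPower`, every field) ⟺ the companion-recurrent
residual. [folklore] -/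
theorem noWildContactFreeOffLocusTowers_iff_g26 (h71 : MaxContactCut.NoContactHuggingTowers) :
    NoWildContactFreeOffLocusTowers ↔ NoWildCompanionKangarooTowers := by
  rw [noWildContactFreeOffLocusTowers_iff_pPower, noWildPPowerOffLocusTowers_iff_g26 h71]

end CompanionCells

end Summit.ResolutionOfSingularities.ResolutionOfSingularities.Theorems.HugValuationCut
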